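import Summits.ABC.IUTFork.LDHSlotRegimePointTransport
import HarnessLib

/-!
# The fork at [IUTchIII] Corollary 3.12, L-DH level, READING (U): the GENERAL pair inequality of the (U)-computable half READ ON THE
# POINT — any place `W` against a (P5)-bad place `V` of `ℚ(j(λ))` over one prime, covering the both-bad mixed primes (abc-iut cell,
# R2 S-chain team seat abc-iut-s2-p1; crux ThetaPartII = stmt-ABC-19678; CONE binder `hvol` / `hreg`)

Record-only PROOF file (D-0012) of the abc-iut cell; TAKES NO SIDE on [IUTchIII] Cor. 3.12 or on the (U)/(P) readings of "−|log(Θ)|".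
Mochizuki, *Inter-universal Teichmüller theory IV* (RIMS manuscript Apr. 2020 = PRIMS **57** (2021)), Thm. 1.10 proof Step (v) pp. 27–28;
Cor. 2.2 (ii) proof p. 46 ((P5), (P7)); Dupuy–Hilado [DupuyHilado2025] §3.3, §3.6, §4.7, §4.12.

abc-iut-S7's `PointDict.pair_le_of_hullEstimateOf` (over abc-iut-S8's forced slot residue) bounds, ON THE DATUM, the weighted
difference of the canonical slot values `μ_T` at ANY two places of `F_mod(E_F)` over a support prime; abc-iut-s2-p5 transported the
bad-vs-non-bad case to the point (`splitPair_le_of_hullVolumeAtDatum`). This file transports the GENERAL case with the lemmas of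
`LDHSlotRegimePointTransport` (`logQloc_finBelow_eq`, `finBelow_mem_badPrimesMod_iff`; abc-iut-s2-p5's `range_algebraMap_adjoin_jInv_eq`,
`weight_finBelow_eq_of_range_eq`): for places `V, W` of `F_mod := ℚ(j(λ)) ⊆ F_tpd` over one prime with `V` (P5)-bad
(`ord_V j(λ) < 0`, `V ∤ 2`, `V ∤ l`) and `W` ARBITRARY, with `h♭(U) := (−ord_U j(λ))·log N(U)/n_U` at bad `U`, `0` otherwise:

* **`PointDict.pointPair_le_of_hullVolumeAtDatum`** — `Cor22.HullVolumeAtDatum P l δ` + a datum ⟹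
  `Pr(V)·Pr(W)·(l(l+1)/12)·((h♭(V) − h♭(W))/(2l)) ≤ δ` — in particular at a prime ALL of whose places are bad but of DIFFERENT
  normalised `q`-order (the mixed primes not covered by the bad-vs-non-bad form), the weighted height DIFFERENCE is bounded;
* **`PointDict.pointPair_le_BIII_of_hvol`** — from `abc_of_S_v3`'s `hvol` VERBATIM at every admissible `(λ, l)` (datum by
  abc-iut-L5-t7's `ThetaPartII.stub_thetaData`), `δ = B_III(λ, l)`.
So, datum-free: at EVERY mixed prime `p` of `λ` (two places of `ℚ(j(λ))` over `p` with `h♭(V) ≠ h♭(W)`, `V` bad) the CONE binder forces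
`Pr(V)·Pr(W)·((l+1)/24)·(h♭(V) − h♭(W)) ≤ B_III(λ,l)`. HONEST SCOPE: transport bookkeeping; no datum constructed; no side taken; typed ≠
proved. PROOF-ONLY file: no definitions. [cite: Mochizuki2012, IUTchIV Thm. 1.10 proof Step (v) p. 27–28]
[cite: Mochizuki2012, IUTchIV Cor. 2.2 (ii) proof p. 46] [cite: DupuyHilado2025, §3.3, §3.6, §4.7, §4.12]
[claim: Mochizuki2012, status: disputed] for every IUT quotation.
-/

noncomputable section

namespace Summit.ABC.IUTFork

open NumberField IsDedekindDomain Literature.IUT.LogVolume Literature.IUT.HodgeTheaters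
open Literature.NumberTheory.DiophantineGeometry.GenEll
open scoped Classical

namespace PointDict

variable {P : NFPoint} {l : ℕ}

/-- **The general pair inequality ON THE POINT.** `Cor22.HullVolumeAtDatum P l δ` and a genuine Θ-volume datum `T` at `(P, l)` force,
for places `V, W` of `ℚ(j(λ))` over one prime `p` with `V` (P5)-bad and `W` arbitrary:
`Pr(V)·Pr(W)·(l(l+1)/12)·((h♭(V) − h♭(W))/(2l)) ≤ δ` (abc-iut-S7's `pair_le_of_hullEstimateOf` on the datum's `F_mod(E_F)`, through places
`x | V`, `y | W` of `F`; `μ_T = logQloc/(2l) = h♭/(2l)` by `logQloc_finBelow_eq`; `p ∈ T(I)` because `V` is bad). The conclusion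
mentions no datum. [cite: Mochizuki2012, IUTchIV Thm. 1.10 proof Step (v) p. 27–28] [cite: DupuyHilado2025, §3.3, §3.6, §4.7, §4.12]
[claim: Mochizuki2012, status: disputed] -/
theorem pointPair_le_of_hullVolumeAtDatum {δ : ℝ} (h : Cor22.HullVolumeAtDatum P l δ) (T : Cor22.ThetaVolumeDatumAt P l)
    (p : ℕ) [Fact p.Prime] (V W : HeightOneSpectrum (𝓞 ↥(IntermediateField.adjoin ℚ ({Cor22.jInv P.x} : Set P.F))))
    (hV : V ∈ placesOver _ p) (hW : W ∈ placesOver _ p)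
    (hVbad : ord _ V (Cor22.jMod P) < 0 ∧ ((2 : ℕ) : 𝓞 _) ∉ V.asIdeal ∧ ((l : ℕ) : 𝓞 _) ∉ V.asIdeal) :
    weight _ V * weight _ W * ((l : ℝ) * ((l : ℝ) + 1) / 12) *
      (((if ord _ V (Cor22.jMod P) < 0 ∧ ((2 : ℕ) : 𝓞 _) ∉ V.asIdeal ∧ ((l : ℕ) : 𝓞 _) ∉ V.asIdeal
          then ((-ord _ V (Cor22.jMod P) : ℤ) : ℝ) * logNorm _ V / (localDegree _ V : ℝ) else 0)
        - (if ord _ W (Cor22.jMod P) < 0 ∧ ((2 : ℕ) : 𝓞 _) ∉ W.asIdeal ∧ ((l : ℕ) : 𝓞 _) ∉ W.asIdeal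
          then ((-ord _ W (Cor22.jMod P) : ℤ) : ℝ) * logNorm _ W / (localDegree _ W : ℝ) else 0)) / (2 * (l : ℝ))) ≤ δ := by
  letI := T.instFieldF; letI := T.instNumberFieldF; letI := T.instAlgebraF; letI := T.instFieldK
  letI := T.instNumberFieldK; letI := T.instAlgebraK; letI := T.instFieldFbar; letI := T.instAlgebraFbar
  letI := T.instAlgebraKFbar; letI := T.instIsElliptic
  set Fm : Type := ↥(IntermediateField.adjoin ℚ ({Cor22.jInv P.x} : Set P.F)) with hFm
  letI : Algebra Fm T.F := ((algebraMap P.F T.F).comp (algebraMap Fm P.F)).toAlgebra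
  set FE : Type := ↥(fieldOfModuli T.E) with hFE
  have hrange : Set.range (algebraMap Fm T.F) = Set.range (algebraMap FE T.F) := range_algebraMap_adjoin_jInv_eq T
  -- places `x | V`, `y | W` of `F` and their restrictions to `F_mod(E_F)`
  obtain ⟨x, hx⟩ := PlaceSection.exists_under_eq (F₀ := Fm) (K := T.F) V
  obtain ⟨y, hy⟩ := PlaceSection.exists_under_eq (F₀ := Fm) (K := T.F) W
  have hxV : finBelow Fm T.F x = V := HeightOneSpectrum.ext (by rw [← hx]; rfl)
  have hyW : finBelow Fm T.F y = W := HeightOneSpectrum.ext (by rw [← hy]; rfl)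
  have hxp : x ∈ placesOver T.F p := by
    rw [mem_placesOver_iff_residueChar] at hV ⊢
    rw [← residueChar_finBelow (F := Fm), hxV, hV]
  have hyp : y ∈ placesOver T.F p := by
    rw [mem_placesOver_iff_residueChar] at hW ⊢
    rw [← residueChar_finBelow (F := Fm), hyW, hW]
  set v' : placesOver FE p := ⟨finBelow FE T.F x, finBelow_mem_placesOver _ T.F hxp⟩ with hv'
  set w' : placesOver FE p := ⟨finBelow FE T.F y, finBelow_mem_placesOver _ T.F hyp⟩ with hw'
  -- `v'` is bad, so `p` is a support prime
  have hv'bad : (finBelow FE T.F x) ∈ ThetaData.badPrimesMod T.D := by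
    have hiff := finBelow_mem_badPrimesMod_iff T x
    rw [hxV] at hiff
    exact hiff.mpr hVbad
  have hpT : p ∈ T.I.supportPrimes := by
    have h1 := residueChar_mem_supportPrimes_of_bad T (finBelow FE T.F x) hv'bad
    rwa [(mem_placesOver_iff_residueChar (finBelow FE T.F x)).mp (finBelow_mem_placesOver _ T.F hxp)] at h1
  -- abc-iut-S7's pair inequality on the datum
  have hS7 := pair_le_of_hullEstimateOf T (h T) p hpT v' w'
  -- `μ_T(u) = logQloc(u)/(2l)` and `logQloc` read on the point
  have hXl : (T.I.X.l : ℝ) = (l : ℝ) := by exact_mod_cast T.isVolumeInputOf.l_eq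
  have hμ : ∀ u : placesOver FE p, T.I.X.qPilot u.1 * logNorm FE u.1 / (localDegree FE u.1 : ℝ) =
      (DHData.ofInput T.I).logQloc p u / (2 * (l : ℝ)) := by
    intro u
    simp only [DHData.logQloc, DHData.ofInput_X]
    rw [PilotData.qPilot_eq_smul, Finsupp.smul_apply, smul_eq_mul, hXl]
    ring
  have hqx := logQloc_finBelow_eq T p x hxp
  have hqy := logQloc_finBelow_eq T p y hyp
  rw [hxV] at hqx
  rw [hyW] at hqy
  have hwV : weight FE (finBelow FE T.F x) = weight Fm V := by
    rw [← hxV]; exact (weight_finBelow_eq_of_range_eq hrange x hxp).symm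
  have hwW : weight FE (finBelow FE T.F y) = weight Fm W := by
    rw [← hyW]; exact (weight_finBelow_eq_of_range_eq hrange y hyp).symm
  rw [hμ v', hμ w'] at hS7
  simp only [hv', hw'] at hS7
  rw [hqx, hqy, hwV, hwW] at hS7
  have e : ∀ a b : ℝ, a / (2 * (l : ℝ)) - b / (2 * (l : ℝ)) = (a - b) / (2 * (l : ℝ)) := fun a b => by ring
  rw [e] at hS7
  exact hS7

/-- **The general pair inequality ON THE POINT, FROM THE CONE BINDER.** From `abc_of_S_v3`'s `hvol` VERBATIM: at every admissible
`(λ, l)` (`λ ∈ U_X` minimal, `l` prime `≥ 5`, «admits an `F`-core», (P2), (P5), (P6); a datum exists by abc-iut-L5-t7's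
`ThetaPartII.stub_thetaData`), for places `V, W` of `ℚ(j(λ))` over one prime with `V` (P5)-bad:
`Pr(V)·Pr(W)·(l(l+1)/12)·((h♭(V) − h♭(W))/(2l)) ≤ B_III(λ, l)` — datum-free, IUT-free.
[cite: Mochizuki2012, IUTchIV Thm. 1.10 proof Step (v) p. 27–28] [cite: Mochizuki2012, IUTchIV Cor. 2.2 (ii) proof p. 46]
[claim: Mochizuki2012, status: disputed] -/
theorem pointPair_le_BIII_of_hvol
    (hvol : ∀ P₀ : NFPoint, P₀ ∈ UP → ∀ l : ℕ, l.Prime → 5 ≤ l →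
      Cor22.AdmitsCore P₀ → Cor22.CondP2 P₀ l → Cor22.CondP5 P₀ l → Cor22.CondP6 P₀ l →
        Cor22.HullVolumeAtDatum P₀ l (((l : ℝ) + 1) / 4 *
          ((1 + 12 * (Cor22.dmod P₀ : ℝ) / l) * (P₀.logDiff + Cor22.logCondAvoid P₀ {2, l})
            + 2 * Real.log l + 52
            + 20 / 3 * Real.log (((2 ^ 12 * 3 ^ 3 * 5 * Cor22.dmod P₀ : ℕ) : ℝ) * (l : ℝ))
              * (Nat.primeCounting (2 ^ 12 * 3 ^ 3 * 5 * Cor22.dmod P₀ * l) : ℝ))))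
    (hP : P ∈ UP) (hl : l.Prime) (h5 : 5 ≤ l) (hcore : Cor22.AdmitsCore P) (h2 : Cor22.CondP2 P l)
    (h5' : Cor22.CondP5 P l) (h6 : Cor22.CondP6 P l)
    (p : ℕ) [Fact p.Prime] (V W : HeightOneSpectrum (𝓞 ↥(IntermediateField.adjoin ℚ ({Cor22.jInv P.x} : Set P.F))))
    (hV : V ∈ placesOver _ p) (hW : W ∈ placesOver _ p)
    (hVbad : ord _ V (Cor22.jMod P) < 0 ∧ ((2 : ℕ) : 𝓞 _) ∉ V.asIdeal ∧ ((l : ℕ) : 𝓞 _) ∉ V.asIdeal) :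
    weight _ V * weight _ W * ((l : ℝ) * ((l : ℝ) + 1) / 12) *
      (((if ord _ V (Cor22.jMod P) < 0 ∧ ((2 : ℕ) : 𝓞 _) ∉ V.asIdeal ∧ ((l : ℕ) : 𝓞 _) ∉ V.asIdeal
          then ((-ord _ V (Cor22.jMod P) : ℤ) : ℝ) * logNorm _ V / (localDegree _ V : ℝ) else 0)
        - (if ord _ W (Cor22.jMod P) < 0 ∧ ((2 : ℕ) : 𝓞 _) ∉ W.asIdeal ∧ ((l : ℕ) : 𝓞 _) ∉ W.asIdeal
          then ((-ord _ W (Cor22.jMod P) : ℤ) : ℝ) * logNorm _ W / (localDegree _ W : ℝ) else 0)) / (2 * (l : ℝ))) ≤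
      ((l : ℝ) + 1) / 4 * ((1 + 12 * (Cor22.dmod P : ℝ) / l) * (P.logDiff + Cor22.logCondAvoid P {2, l})
        + 2 * Real.log l + 52 + 20 / 3 * Real.log (((2 ^ 12 * 3 ^ 3 * 5 * Cor22.dmod P : ℕ) : ℝ) * (l : ℝ))
          * (Nat.primeCounting (2 ^ 12 * 3 ^ 3 * 5 * Cor22.dmod P * l) : ℝ)) := by
  obtain ⟨T⟩ := Summit.ABC.ABC.Theorems.ThetaPartII.stub_thetaData P hP l hl h5 hcore h2 h5' h6
  exact pointPair_le_of_hullVolumeAtDatum (hvol P hP l hl h5 hcore h2 h5' h6) T p V W hV hW hVbad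

end PointDict

end Summit.ABC.IUTFork

end
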